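import Literature.MeasureTheory.Lebesgue.SaturatedNonmeasurableSet
import Mathlib.Data.Nat.Factorization.Basic
import HarnessLib

/-!
# A countable partition of the line into sets with outer-full pieces, and the labelling lemma

`Summits/NavierStokesRegularity/NavierStokesRegularity/Theorems/TaoForcedUniqueness/Negative/`
(theorems only, everything PROVED; no definitions, no named facts; generic measure theory filed on the
Summits side because the statements are ours, not a printed theorem — infrastructure for the
measurability-hygiene refutations of the forced Leray–Hopf named facts, ns-blowup KILLSHEET K54 / KJ-6:
"countable switched junk-force families"; companion of `MemLqLpNonBochnerForce.lean`). Refines Halmos's two-sided saturated set (`exists_saturated_real`: `M = V + D`, `V` a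
transversal of `ℝ/ℚ`, `D` the dyadic rationals — Halmos 1950, §16 Thm. E) to a **countable
partition** `ℝ = ⨆ₘ Pₘ` in which EVERY piece is saturated from outside: every Lebesgue measurable
subset of `Pₘᶜ` is null (equivalently, `Pₘ` meets every non-null measurable set). Construction:
`Pₘ = V + {q ∈ ℚ : the odd part of the denominator of q is 2m+1}`; the odd part of the denominator
(`ordCompl[2] q.den`) is invariant under translation by dyadic rationals, so each `Pₘ` is a union of
translates `V + D + q` of Halmos's `M`, is `D`-invariant, and the zero–one law for `D`-invariant
measurable sets (`volume_eq_zero_or_compl_of_preimage_add_eq`, Halmos §16 Exercise (1)) together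
with the positivity of the outer measure of `M` (its rational translates cover `ℝ`) gives the
saturation of each piece exactly as in the proof of Theorem E.

**Labelling lemma** (the use of such partitions in measurability counterexamples): if `ℓ : ℝ → ℕ`
labels the pieces (`t ∈ Pₘ → ℓ t = m`) and `k m : ℝ → ℝ` are measurable, then the superposition
`t ↦ k (ℓ t) t` is a.e.-strongly measurable on a measurable set `S` only if it agrees a.e. on `S`
with EACH `k m` — so the `k m` all agree a.e. on `S`; contrapositively, as soon as two members of the
family differ on a non-null part of `S`, the superposition is not a.e.-strongly measurable and its
Bochner integral over `S` is the junk value `0` (`integral_label_eq_zero`). This is the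
"countable switch" device: one non-measurable label function hides countably many measurable
integrands behind a single non-measurable one.

Main results (namespace `Summit.NavierStokesRegularity.ForcedUniquenessHygiene`):
* `ordCompl_two_den_add_dyadic` — `ordCompl[2] (q + n/2ᵏ).den = ordCompl[2] q.den`;
* `exists_saturated_partition` — `∃ P : ℕ → Set ℝ`, pairwise disjoint, `⋃ₘ Pₘ = univ`, and
  `∀ m F, MeasurableSet F → F ⊆ (P m)ᶜ → volume F = 0`;
* `ae_eq_of_aestronglyMeasurable_label`, `not_aestronglyMeasurable_label`,
  `integral_label_eq_zero` — the labelling lemma and its junk-integral corollary.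

## Mathlib / tree search

Tree: `Vitali.exists_transversal` (`VitaliSet.lean`), `saturation_props`, `dyadic_add`, `dyadic_sub`,
`dyadic_rat`, `dense_dyadic`, `exists_saturated_real` (`SaturatedNonmeasurableSet.lean`),
`volume_eq_zero_or_compl_of_preimage_add_eq` (`DenseInvariantZeroOne.lean`); no partition or
labelling statement (`lean search 'saturated partition|label'`: none). Mathlib: `Nat.ordCompl_dvd_ordCompl_of_dvd`,
`Nat.ordCompl_self_pow_mul`, `Nat.coprime_ordCompl`, `Nat.coprime_two_left`, `Rat.add_den_dvd`,
`Rat.den_dvd`, `Rat.intCast_div_eq_divInt`, `measure_preimage_add_right`,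
`integral_non_aestronglyMeasurable`.

## References

* P. R. Halmos, *Measure Theory*, Van Nostrand (1950) = Springer GTM 18, §16 Theorem E and
  Exercise (1) (held copy, PDF pp. 83–84). [Halmos1950]
-/

noncomputable section

open MeasureTheory Set Filter Topology
open scoped ENNReal

namespace Summit.NavierStokesRegularity.ForcedUniquenessHygiene

open Literature.MeasureTheory.Lebesgue

/-! ### The odd part of the denominator is invariant under dyadic translation -/

/-- Adding a dyadic rational `n / 2ᵏ` does not create odd prime factors in the denominator:
`ordCompl[2] (q + n/2ᵏ).den ∣ ordCompl[2] q.den` (from `(q + r).den ∣ q.den · r.den` and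
`r.den ∣ 2ᵏ`). [folklore] -/
theorem ordCompl_two_den_add_dyadic_dvd (q : ℚ) (n : ℤ) (k : ℕ) :
    ordCompl[2] (q + (n : ℚ) / 2 ^ k).den ∣ ordCompl[2] q.den := by
  set r : ℚ := (n : ℚ) / 2 ^ k with hr
  have hr' : r = Rat.divInt n ((2 : ℤ) ^ k) := by
    rw [hr, ← Rat.intCast_div_eq_divInt]
    push_cast
    rfl
  have hden : r.den ∣ 2 ^ k := by
    have h := Rat.den_dvd n ((2 : ℤ) ^ k)
    rw [← hr'] at h
    have h2 : ((2 : ℤ) ^ k) = ((2 ^ k : ℕ) : ℤ) := by push_cast; rfl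
    rw [h2] at h
    exact Int.natCast_dvd_natCast.mp h
  have h1 : (q + r).den ∣ 2 ^ k * q.den :=
    calc (q + r).den ∣ q.den * r.den := Rat.add_den_dvd q r
      _ ∣ q.den * 2 ^ k := mul_dvd_mul_left _ hden
      _ = 2 ^ k * q.den := mul_comm _ _
  have h2 := Nat.ordCompl_dvd_ordCompl_of_dvd h1 2
  rwa [Nat.ordCompl_self_pow_mul q.den k Nat.prime_two] at h2

/-- **The odd part of the denominator is a `ℤ[1/2]`-coset invariant**:
`ordCompl[2] (q + n/2ᵏ).den = ordCompl[2] q.den`. [folklore] -/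
theorem ordCompl_two_den_add_dyadic (q : ℚ) (n : ℤ) (k : ℕ) :
    ordCompl[2] (q + (n : ℚ) / 2 ^ k).den = ordCompl[2] q.den := by
  refine Nat.dvd_antisymm (ordCompl_two_den_add_dyadic_dvd q n k) ?_
  have h := ordCompl_two_den_add_dyadic_dvd (q + (n : ℚ) / 2 ^ k) (-n) k
  have heq : q + (n : ℚ) / 2 ^ k + ((-n : ℤ) : ℚ) / 2 ^ k = q := by push_cast; ring
  rwa [heq] at h

/-- The odd part of a (nonzero) denominator is odd. [folklore] -/
theorem odd_ordCompl_two_den (q : ℚ) : Odd (ordCompl[2] q.den) :=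
  Nat.coprime_two_left.mp (Nat.coprime_ordCompl Nat.prime_two q.den_ne_zero)

/-- `1/(2m+1)` has odd denominator part `2m+1`. [folklore] -/
theorem ordCompl_two_den_inv_odd (m : ℕ) : ordCompl[2] ((1 : ℚ) / (2 * m + 1)).den = 2 * m + 1 := by
  have hden : ((1 : ℚ) / (2 * m + 1)).den = 2 * m + 1 := by
    have h : ((1 : ℚ) / (2 * m + 1)) = ((2 * m + 1 : ℕ) : ℚ)⁻¹ := by push_cast; ring
    rw [h, Rat.inv_natCast_den_of_pos (by omega)]
  rw [hden]
  have hodd : Odd (2 * m + 1) := ⟨m, rfl⟩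
  have hcop : Nat.Coprime 2 (2 * m + 1) := Nat.coprime_two_left.mpr hodd
  have h0 : (2 * m + 1).factorization 2 = 0 :=
    Nat.factorization_eq_zero_of_not_dvd fun h => by
      have := (Nat.coprime_two_left.mp hcop)
      exact (Nat.not_even_iff_odd.mpr this) (even_iff_two_dvd.mpr h)
  simp [h0]

/-! ### The saturated partition -/

/-- **A countable partition of `ℝ` into outer-full pieces.** There are pairwise disjoint sets
`Pₘ ⊆ ℝ`, `m ∈ ℕ`, covering the line, such that for every `m` every Lebesgue measurable subset of the
complement `Pₘᶜ` is null. (`Pₘ = V + {q ∈ ℚ : ordCompl[2] q.den = 2m+1}`, `V` a transversal of `ℝ/ℚ`;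
Halmos's Theorem E argument piece by piece.) [cite: Halmos1950, §16 Theorem E (PDF p. 84)] -/
theorem exists_saturated_partition :
    ∃ P : ℕ → Set ℝ, Pairwise (Function.onFun Disjoint P) ∧ (⋃ m, P m) = univ ∧
      ∀ (m : ℕ) (F : Set ℝ), MeasurableSet F → F ⊆ (P m)ᶜ → volume F = 0 := by
  obtain ⟨V, -, hcov, hV⟩ := Vitali.exists_transversal 0 zero_lt_one
  set P : ℕ → Set ℝ := fun m =>
    {x : ℝ | ∃ v ∈ V, ∃ q : ℚ, ordCompl[2] q.den = 2 * m + 1 ∧ x = v + q} with hP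
  -- Halmos's `M = V + D` and the positivity of its outer measure
  set M : Set ℝ := {x : ℝ | ∃ v ∈ V, ∃ d : ℝ, (∃ (n : ℤ) (k : ℕ), d = n / 2 ^ k) ∧ x = v + d}
    with hM
  have hcover : ∀ x : ℝ, ∃ q : ℚ, x + -(q : ℝ) ∈ M := by
    intro x
    obtain ⟨v, hv, q, rfl⟩ := hcov x
    exact ⟨q, v, hv, 0, ⟨0, 0, by simp⟩, by ring⟩
  have hM0 : volume M ≠ 0 := by
    intro h0
    have h1 : ∀ q : ℚ, volume ((fun x => x + -(q : ℝ)) ⁻¹' M) = 0 := fun q => by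
      rw [measure_preimage_add_right]; exact h0
    have h2 : (univ : Set ℝ) ⊆ ⋃ q : ℚ, (fun x => x + -(q : ℝ)) ⁻¹' M := fun x _ => by
      obtain ⟨q, hq⟩ := hcover x
      exact mem_iUnion.2 ⟨q, hq⟩
    exact (by simp : volume (univ : Set ℝ) ≠ 0) (measure_mono_null h2 (measure_iUnion_null h1))
  -- each piece contains a translate of `M` and is `D`-invariant
  have hMP : ∀ m : ℕ, ∀ x ∈ M, x + (1 : ℝ) / (2 * m + 1) ∈ P m := by
    rintro m x ⟨v, hv, d, ⟨n, k, rfl⟩, rfl⟩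
    refine ⟨v, hv, (1 : ℚ) / (2 * m + 1) + (n : ℚ) / 2 ^ k, ?_, ?_⟩
    · rw [ordCompl_two_den_add_dyadic, ordCompl_two_den_inv_odd]
    · push_cast; ring
  have hPinv : ∀ m : ℕ, ∀ d : ℝ, (∃ (n : ℤ) (k : ℕ), d = n / 2 ^ k) → ∀ x ∈ P m, x + d ∈ P m := by
    rintro m d ⟨n, k, rfl⟩ x ⟨v, hv, q, hq, rfl⟩
    refine ⟨v, hv, q + (n : ℚ) / 2 ^ k, ?_, ?_⟩
    · rw [ordCompl_two_den_add_dyadic, hq]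
    · push_cast; ring
  have hPcinv : ∀ m : ℕ, ∀ d : ℝ, (∃ (n : ℤ) (k : ℕ), d = n / 2 ^ k) →
      ∀ x ∈ (P m)ᶜ, x + d ∈ (P m)ᶜ := by
    intro m d hd x hx hxd
    have h1 : x + d + -d ∈ P m := hPinv m (-d) (by
      obtain ⟨n, k, rfl⟩ := hd
      exact ⟨-n, k, by push_cast; ring⟩) _ hxd
    exact hx (by simpa using h1)
  refine ⟨P, ?_, ?_, ?_⟩
  · -- pairwise disjoint: `v + q = v' + q'` forces `v = v'`, `q = q'`
    intro m m' hne
    rw [Function.onFun, Set.disjoint_left]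
    rintro x ⟨v, hv, q, hq, rfl⟩ ⟨v', hv', q', hq', h⟩
    have hvv' : v' = v := hV v hv v' hv' (q - q') (by push_cast; linarith)
    rw [hvv'] at h
    have hqq' : (q : ℝ) = q' := by linarith
    have hqq : q = q' := by exact_mod_cast hqq'
    rw [hqq] at hq
    omega
  · -- cover: the label of `x = v + q` is `(ordCompl[2] q.den - 1) / 2`
    refine eq_univ_of_forall fun x => ?_
    obtain ⟨v, hv, q, rfl⟩ := hcov x
    refine mem_iUnion.2 ⟨ordCompl[2] q.den / 2, v, hv, q, ?_, rfl⟩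
    exact (Nat.two_mul_div_two_add_one_of_odd (odd_ordCompl_two_den q)).symm
  · -- saturation of each piece from outside
    intro m F hF hFM
    obtain ⟨hSm, hFS, hSM, hSinv⟩ := saturation_props hF hFM (hPcinv m)
    rcases volume_eq_zero_or_compl_of_preimage_add_eq hSm dense_dyadic hSinv with h0 | h0
    · exact measure_mono_null hFS h0
    · exfalso
      -- `P m ⊆ Sᶜ` would be null, hence `M + 1/(2m+1) ⊆ P m` null, hence `M` null
      have hPm0 : volume (P m) = 0 :=
        measure_mono_null (fun x hx hxS => hSM hxS hx) h0
      have h1 : volume ((fun x => x + (1 : ℝ) / (2 * m + 1)) ⁻¹' (P m)) = 0 := by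
        rw [measure_preimage_add_right]; exact hPm0
      exact hM0 (measure_mono_null (fun x hx => hMP m x hx) h1)

/-! ### The labelling lemma -/

/-- **Labelling lemma.** Let the pieces `Pₘ` be saturated from outside and let `ℓ` label them
(`t ∈ Pₘ → ℓ t = m`). If the superposition `t ↦ k (ℓ t) t` of measurable functions `k m` is
a.e.-strongly measurable on a measurable set `S`, then it agrees a.e. on `S` with every `k m`
(the set where a measurable modification differs from `k m` is a measurable subset of `Pₘᶜ` up to a
null set). [folklore] -/
theorem ae_eq_of_aestronglyMeasurable_label {P : ℕ → Set ℝ}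
    (hP : ∀ (m : ℕ) (F : Set ℝ), MeasurableSet F → F ⊆ (P m)ᶜ → volume F = 0)
    {ℓ : ℝ → ℕ} (hℓ : ∀ m, ∀ t ∈ P m, ℓ t = m) {k : ℕ → ℝ → ℝ} (hk : ∀ m, Measurable (k m))
    {S : Set ℝ} (hS : MeasurableSet S)
    (h : AEStronglyMeasurable (fun t => k (ℓ t) t) (volume.restrict S)) (m : ℕ) :
    ∀ᵐ t ∂(volume.restrict S), k (ℓ t) t = k m t := by
  set μ : Measure ℝ := volume.restrict S with hμ
  set g : ℝ → ℝ := h.mk _ with hg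
  have hgm : Measurable g := h.stronglyMeasurable_mk.measurable
  have hfg : (fun t => k (ℓ t) t) =ᵐ[μ] g := h.ae_eq_mk
  -- a measurable `μ`-null set off which the superposition equals `g`
  set N : Set ℝ := toMeasurable μ {t | k (ℓ t) t ≠ g t} with hN
  have hNm : MeasurableSet N := measurableSet_toMeasurable _ _
  have hN0 : μ N = 0 := by rw [hN, measure_toMeasurable]; exact hfg
  -- the measurable set where `g ≠ k m` is null: off `N` it lies in `(P m)ᶜ`
  have hEm : MeasurableSet {t | g t ≠ k m t} := (measurableSet_eq_fun hgm (hk m)).compl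
  have hE0 : μ {t | g t ≠ k m t} = 0 := by
    have hsub : ({t | g t ≠ k m t} ∩ S) \ N ⊆ (P m)ᶜ := by
      rintro t ⟨⟨ht, -⟩, htN⟩ htP
      have h1 : k (ℓ t) t = g t := by
        by_contra hne
        exact htN (subset_toMeasurable μ _ hne)
      rw [hℓ m t htP] at h1
      exact ht h1.symm
    have h1 : volume (({t | g t ≠ k m t} ∩ S) \ N) = 0 := hP m _ ((hEm.inter hS).diff hNm) hsub
    have h2 : μ ({t | g t ≠ k m t} \ N) = 0 := by
      rw [hμ, Measure.restrict_apply (hEm.diff hNm)]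
      have : ({t | g t ≠ k m t} \ N) ∩ S = ({t | g t ≠ k m t} ∩ S) \ N := by
        ext t; simp only [mem_inter_iff, Set.mem_sdiff]; tauto
      rw [this]; exact h1
    refine measure_mono_null (fun t ht => ?_) (measure_union_null h2 hN0)
    by_cases htN : t ∈ N
    · exact Or.inr htN
    · exact Or.inl ⟨ht, htN⟩
  have h1 : ∀ᵐ t ∂μ, g t = k m t := by
    rw [ae_iff]; simpa only [not_not] using hE0
  filter_upwards [hfg, h1] with t ht ht'
  rw [ht, ht']

/-- **Contrapositive form**: if for some `m` the superposition differs from `k m` on a non-null part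
of `S`, it is not a.e.-strongly measurable on `S`. [folklore] -/
theorem not_aestronglyMeasurable_label {P : ℕ → Set ℝ}
    (hP : ∀ (m : ℕ) (F : Set ℝ), MeasurableSet F → F ⊆ (P m)ᶜ → volume F = 0)
    {ℓ : ℝ → ℕ} (hℓ : ∀ m, ∀ t ∈ P m, ℓ t = m) {k : ℕ → ℝ → ℝ} (hk : ∀ m, Measurable (k m))
    {S : Set ℝ} (hS : MeasurableSet S) {m : ℕ}
    (hne : ¬ ∀ᵐ t ∂(volume.restrict S), k (ℓ t) t = k m t) :
    ¬ AEStronglyMeasurable (fun t => k (ℓ t) t) (volume.restrict S) :=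
  fun h => hne (ae_eq_of_aestronglyMeasurable_label hP hℓ hk hS h m)

/-- **Junk corollary**: under the same hypothesis the Bochner integral of the superposition over
`S` is `0` (`integral_non_aestronglyMeasurable`). [folklore] -/
theorem integral_label_eq_zero {P : ℕ → Set ℝ}
    (hP : ∀ (m : ℕ) (F : Set ℝ), MeasurableSet F → F ⊆ (P m)ᶜ → volume F = 0)
    {ℓ : ℝ → ℕ} (hℓ : ∀ m, ∀ t ∈ P m, ℓ t = m) {k : ℕ → ℝ → ℝ} (hk : ∀ m, Measurable (k m))
    {S : Set ℝ} (hS : MeasurableSet S) {m : ℕ}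
    (hne : ¬ ∀ᵐ t ∂(volume.restrict S), k (ℓ t) t = k m t) :
    ∫ t in S, k (ℓ t) t = 0 :=
  integral_non_aestronglyMeasurable (not_aestronglyMeasurable_label hP hℓ hk hS hne)

/-- **Two labels suffice**: if `k m` and `k m'` differ on a non-null part of `S`, the superposition is
not a.e.-strongly measurable on `S` (it cannot agree a.e. with both). [folklore] -/
theorem not_aestronglyMeasurable_label_of_ne {P : ℕ → Set ℝ}
    (hP : ∀ (m : ℕ) (F : Set ℝ), MeasurableSet F → F ⊆ (P m)ᶜ → volume F = 0)
    {ℓ : ℝ → ℕ} (hℓ : ∀ m, ∀ t ∈ P m, ℓ t = m) {k : ℕ → ℝ → ℝ} (hk : ∀ m, Measurable (k m))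
    {S : Set ℝ} (hS : MeasurableSet S) {m m' : ℕ}
    (hne : ¬ ∀ᵐ t ∂(volume.restrict S), k m t = k m' t) :
    ¬ AEStronglyMeasurable (fun t => k (ℓ t) t) (volume.restrict S) := by
  intro h
  apply hne
  filter_upwards [ae_eq_of_aestronglyMeasurable_label hP hℓ hk hS h m,
    ae_eq_of_aestronglyMeasurable_label hP hℓ hk hS h m'] with t ht ht'
  rw [← ht, ht']

end Summit.NavierStokesRegularity.ForcedUniquenessHygiene
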